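import Summits.ValiantsHypothesis.ValiantsHypothesis.Theorems.SymPencilSingFiveLeafRowsNormal

/-!
# Route `SymPencil` — the V-side of the size-27 cell `(11, 5, 4)`, PORT of val-idea-18's cascade, leaf R1N: kernel-plane tools and GRAPH
# (`--supports` stmt-ValiantsHypothesis-5674 `SdcSuperquadratic`; verbatim port of §2i–2j of
# `Cruxes/SdcSuperquadratic/Lines/sing_five_classification.lean` rev 10 (val-idea-18 g5); PORT-PLAN-115.md; rung currency only)

Memo §6.4: `dep_absurd`, `T3_single_symm`, `T3_single_compl`, (K1) `permOrth_of_ker3` (a zero-diagonal symmetric pairing vanishing on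
a `3`-space vanishes), (K2) `ker_permOrth` (the kernel plane of a rank-`≥ 3` live row is perm-orthogonal), `finrank_sup_single`,
`finrank_le_two_of_vanish2`, and `graph_false` (the GRAPH kernel plane is impossible).

Honest framing: [folklore] a verbatim port; `27 ≤ sdc(per₄) ≤ 29` unchanged; the crux `SdcSuperquadratic` and `VP ≠ VNP` untouched; no summit
statement is proved here.  No definitions, no named facts.
-/

noncomputable section

-- single-conjunct layout: Sub = Summit, duplicated namespace component intended
set_option linter.dupNamespace false

namespace Summit.ValiantsHypothesis.ValiantsHypothesis.Theorems.SymPencilSingFiveClassification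

open MvPolynomial Module Matrix
open scoped Polynomial
open Literature.Computability.AlgebraicComplexity
open Summit.ValiantsHypothesis.ValiantsHypothesis.Theorems
open Summit.ValiantsHypothesis.ValiantsHypothesis.Theorems.SymPencilSingSixClassification
open Summit.ValiantsHypothesis.ValiantsHypothesis.Theorems.SymPencilPerFourJointFamilyTransport

variable {K : Type*} [Field K]

/-- Two vectors of a line cannot have crossed zero patterns. [folklore] -/
theorem dep_absurd (R : Submodule K (Fin 4 → K)) (hR : finrank K R ≤ 1) {v₁ v₂ : Fin 4 → K}
    (h1 : v₁ ∈ R) (h2 : v₂ ∈ R) (k l : Fin 4) (h1l : v₁ l ≠ 0) (h1k : v₁ k = 0) (h2k : v₂ k ≠ 0) :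
    False := by
  have hne : (⟨v₂, h2⟩ : R) ≠ 0 := by
    intro h
    apply h2k
    have := congr_arg (fun z : R => (z : Fin 4 → K) k) h
    simpa using this
  have h1R : finrank K R = 1 := by
    have hpos : 0 < finrank K R := Module.finrank_pos_iff_exists_ne_zero.2 ⟨_, hne⟩
    omega
  obtain ⟨c, hc⟩ := (finrank_eq_one_iff_of_nonzero' (K := K) (V := R) ⟨v₂, h2⟩ hne).1 h1R ⟨v₁, h1⟩
  have hk := congr_arg (fun z : R => (z : Fin 4 → K) k) hc
  have hl := congr_arg (fun z : R => (z : Fin 4 → K) l) hc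
  simp only [SetLike.mk_smul_mk, Pi.smul_apply, smul_eq_mul] at hk hl
  rw [h1k] at hk
  rcases mul_eq_zero.1 hk with h0 | h0
  · rw [h0, zero_mul] at hl
    exact h1l hl.symm
  · exact h2k h0

/-- `T3 e_l a b k = T3 e_k a b l` (both are the `2 × 2` permanent of `(a;b)` on the complement of
`{k,l}`, for `k ≠ l`). [folklore] -/
theorem T3_single_symm (a b : Fin 4 → K) (k l : Fin 4) :
    T3 (Pi.single l 1) a b k = T3 (Pi.single k 1) a b l := by
  fin_cases k <;> fin_cases l <;> simp [T3, Fin.succAbove]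

/-- `T3 (e_{ck p q}, a, b)_{cl p q}` is the pairing `m_{pq}(a,b)`. [folklore] -/
theorem T3_single_compl (a b : Fin 4 → K) : ∀ p q : Fin 4, p ≠ q →
    T3 (Pi.single (ck p q) 1) a b (cl p q) = pairPerm a b p q := by
  intro p q hpq
  fin_cases p <;> fin_cases q <;> first
    | exact absurd rfl hpq
    | (simp [ck, cl, T3, Fin.succAbove, pairPerm]; try ring)

/-- **(K1) Kernel perm-orthogonality**: if `T3 u a b ≡ 0` for all `u` in a subspace of dimension
`≥ 3`, then `a ⊥ b` (a zero-diagonal symmetric `4 × 4` matrix with a `3`-dimensional kernel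
vanishes). [folklore] -/
theorem permOrth_of_ker3 (A : Submodule K (Fin 4 → K)) (hA : 3 ≤ finrank K A) (a b : Fin 4 → K)
    (h : ∀ u ∈ A, ∀ l, T3 u a b l = 0) : PermOrth a b := by
  set Pm := Pmap a b with hPm
  have hker : A ≤ LinearMap.ker Pm := by
    intro u hu
    rw [LinearMap.mem_ker]
    ext l
    rw [hPm, Pmap_apply, Pi.zero_apply]
    exact h u hu l
  have hR : finrank K (LinearMap.range Pm) ≤ 1 := by
    have h1 := LinearMap.finrank_range_add_finrank_ker Pm
    rw [Module.finrank_fintype_fun_eq_card, Fintype.card_fin] at h1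
    have h2 := Submodule.finrank_mono hker
    omega
  have key : ∀ k l : Fin 4, k ≠ l → Pm (Pi.single k 1) l ≠ 0 → False := by
    intro k l _ hv
    refine dep_absurd _ hR (LinearMap.mem_range_self Pm (Pi.single k 1))
      (LinearMap.mem_range_self Pm (Pi.single l 1)) k l hv ?_ ?_
    · rw [hPm, Pmap_apply]
      exact T3_single_self a b k
    · rw [hPm, Pmap_apply, T3_single_symm]
      exact hv
  intro p q hpq
  by_contra hne
  refine key (ck p q) (cl p q) (ck_ne_cl p q hpq) ?_
  rw [hPm, Pmap_apply, T3_single_compl a b p q hpq]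
  exact hne

/-! ## 2j. Leaf R1N — the kernel plane of a rank-`3` live row (memo §6.4) -/

/-- **(K2) Kernel-plane perm-orthogonality**: if the live row `r` has rank `≥ 3`, the two other
live rows of any `k ∈ K_r` are perm-orthogonal (`polar` + (K1)). [folklore] -/
theorem ker_permOrth [CharZero K] {W : Submodule K (Fin 4 × Fin 4 → K)} (hS : Sing3 W)
    {r s t : Fin 4} (hrs : r ≠ s) (hrt : r ≠ t) (hst : s ≠ t)
    (h3 : 3 ≤ finrank K (W.map (rowL (K := K) r))) {k : Fin 4 × Fin 4 → K} (hk : k ∈ W)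
    (hkr : row k r = 0) : PermOrth (row k s) (row k t) := by
  refine permOrth_of_ker3 (W.map (rowL (K := K) r)) h3 (row k s) (row k t) ?_
  rintro _ ⟨x, hx, rfl⟩ l
  exact polar hS hrs hrt hst hx hk hkr l

/-- Adjoining a coordinate vector `e_m` to a subspace of `e_m^⊥` raises the dimension by one. [folklore] -/
theorem finrank_sup_single (A : Submodule K (Fin 4 → K)) (m : Fin 4) (h : ∀ u ∈ A, u m = 0) :
    finrank K ↥(A ⊔ K ∙ (Pi.single m (1 : K) : Fin 4 → K)) = finrank K A + 1 := by
  have hne : (Pi.single m (1 : K) : Fin 4 → K) ≠ 0 := by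
    intro h0
    have := congr_fun h0 m
    simp at this
  have hinf : A ⊓ (K ∙ (Pi.single m (1 : K) : Fin 4 → K)) = ⊥ := by
    rw [Submodule.eq_bot_iff]
    intro u hu
    obtain ⟨huA, huS⟩ := Submodule.mem_inf.1 hu
    obtain ⟨a, rfl⟩ := Submodule.mem_span_singleton.1 huS
    have := h _ huA
    simp only [Pi.smul_apply, Pi.single_eq_same, smul_eq_mul, mul_one] at this
    simp [this]
  have h1 := Submodule.finrank_sup_add_finrank_inf_eq A (K ∙ (Pi.single m (1 : K) : Fin 4 → K))
  rw [hinf, finrank_bot, finrank_span_singleton hne] at h1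
  omega

/-- A subspace of `K⁴` killed by two distinct coordinates has dimension `≤ 2`. [folklore] -/
theorem finrank_le_two_of_vanish2 (A : Submodule K (Fin 4 → K)) (m₁ m₂ : Fin 4)
    (hne : m₁ ≠ m₂) (h₁ : ∀ u ∈ A, u m₁ = 0) (h₂ : ∀ u ∈ A, u m₂ = 0) :
    finrank K A ≤ 2 := by
  set B := A ⊔ K ∙ (Pi.single m₁ (1 : K) : Fin 4 → K) with hB
  have hB1 : finrank K B = finrank K A + 1 := finrank_sup_single A m₁ h₁
  have hB2 : ∀ u ∈ B, u m₂ = 0 := by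
    intro u hu
    obtain ⟨a, ha, z, hz, rfl⟩ := Submodule.mem_sup.1 hu
    obtain ⟨c, rfl⟩ := Submodule.mem_span_singleton.1 hz
    simp [h₂ a ha, hne.symm]
  have hC := finrank_sup_single B m₂ hB2
  have hle := Submodule.finrank_le (B ⊔ K ∙ (Pi.single m₂ (1 : K) : Fin 4 → K))
  rw [Module.finrank_fintype_fun_eq_card, Fintype.card_fin] at hle
  omega

/-- **GRAPH kernel plane is impossible** (memo §6.4): a graph plane has no pure elements, so (T1′)
applies to both pairs `(r,s)`, `(r,t)`; equal common columns give a zero column, distinct ones force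
`n_r ≤ 2`. [folklore] -/
theorem graph_false [CharZero K] (W : Submodule K (Fin 4 × Fin 4 → K)) (h5 : finrank K W = 5)
    (hrow : ∀ x ∈ W, ∀ j : Fin 4, x (3, j) = 0)
    (hncol : ¬ ∃ j : Fin 4, ∀ x ∈ W, ∀ i : Fin 4, x (i, j) = 0) (hP : PerDirFour W)
    (r s t : Fin 4) (hrs : r ≠ s) (hrt : r ≠ t) (hr3 : r ≠ 3) (hs3 : s ≠ 3)
    (ht3 : t ≠ 3) (hcov : ∀ i : Fin 4, i = r ∨ i = s ∨ i = t ∨ i = 3)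
    (hn3 : finrank K (W.map (rowL (K := K) r)) = 3)
    (j c : Fin 4) (e : K) (he : e ≠ 0)
    (hG : ∀ d, d ∈ kerPlane W r ↔ ((∀ i, i ≠ s → i ≠ t → row d i = 0) ∧
      (∀ i, i ≠ j → i ≠ c → d (s, i) = 0 ∧ d (t, i) = 0) ∧
      d (t, j) = e * d (s, j) ∧ d (t, c) = -(e * d (s, c)))) :
    False := by
  have zero_of : ∀ x ∈ W, (∀ m, x (r, m) = 0) → (∀ m, x (s, m) = 0) → (∀ m, x (t, m) = 0) →
      x = 0 := by
    intro x hx h1 h2 h3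
    ext ⟨i, m⟩
    rw [Pi.zero_apply]
    rcases hcov i with rfl | rfl | rfl | rfl
    · exact h1 m
    · exact h2 m
    · exact h3 m
    · exact hrow x hx m
  have nps : ∀ x ∈ W, (∀ m, x (r, m) = 0) → (∀ m, x (t, m) = 0) → x = 0 := by
    intro x hx h1 h3
    have hxD : x ∈ kerPlane W r := (mem_kerPlane W r x).2 ⟨hx, funext fun m => h1 m⟩
    obtain ⟨-, hoff, hj', hc'⟩ := (hG x).1 hxD
    refine zero_of x hx h1 ?_ h3
    intro m
    by_cases hmj : m = j
    · subst hmj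
      rw [h3] at hj'
      exact (mul_eq_zero.1 hj'.symm).resolve_left he
    by_cases hmc : m = c
    · subst hmc
      rw [h3] at hc'
      exact (mul_eq_zero.1 (neg_eq_zero.1 hc'.symm)).resolve_left he
    · exact (hoff m hmj hmc).1
  have npt : ∀ x ∈ W, (∀ m, x (r, m) = 0) → (∀ m, x (s, m) = 0) → x = 0 := by
    intro x hx h1 h2
    have hxD : x ∈ kerPlane W r := (mem_kerPlane W r x).2 ⟨hx, funext fun m => h1 m⟩
    obtain ⟨-, hoff, hj', hc'⟩ := (hG x).1 hxD
    refine zero_of x hx h1 h2 ?_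
    intro m
    by_cases hmj : m = j
    · subst hmj
      rw [h2, mul_zero] at hj'
      exact hj'
    by_cases hmc : m = c
    · subst hmc
      rw [h2, mul_zero, neg_zero] at hc'
      exact hc'
    · exact (hoff m hmj hmc).2
  obtain ⟨m₁, hm₁⟩ := common_col_gen W h5 hrow hP r s hrs hr3 hs3
    (fun x hx h1 h2 => npt x hx h1 h2)
  obtain ⟨m₂, hm₂⟩ := common_col_gen W h5 hrow hP r t hrt hr3 ht3
    (fun x hx h1 h3 => nps x hx h1 h3)
  by_cases hm : m₁ = m₂
  · subst hm
    refine hncol ⟨m₁, fun x hx i => ?_⟩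
    rcases hcov i with rfl | rfl | rfl | rfl
    · exact (hm₁ x hx).1
    · exact (hm₁ x hx).2
    · exact (hm₂ x hx).2
    · exact hrow x hx m₁
  · have hle := finrank_le_two_of_vanish2 (W.map (rowL (K := K) r)) m₁ m₂ hm
      (by
        rintro _ ⟨y, hy, rfl⟩
        exact (hm₁ y hy).1)
      (by
        rintro _ ⟨y, hy, rfl⟩
        exact (hm₂ y hy).1)
    omega

end Summit.ValiantsHypothesis.ValiantsHypothesis.Theorems.SymPencilSingFiveClassification
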